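import Summits.QuantumFields.BalabanUV.T4Continuum.Support.NE3CoarseFrameData
import Summits.QuantumFields.BalabanUV.T4Continuum.Support.GaugeFieldPerturbation
import HarnessLib

/-!
# T⁴ programme, node NE3 — row E-MLw-(w4)-P-curved, route H♮, row K5c (kit): THE VERTEX DEFECT — a cube-vertex datum read in the
# corner frame through a fine site, against the covariant cube increment, a three-leg loop and the `U`-vs-`bseg` chain

NE3 (node U1b) formalisation swarm, leaf seat `b2b-balaban-t4-ne3-formalise-leaf-01` (gen 6); row **K5** of ruling ρ-g22-2
(`HOME/t4/b2b-balaban-t4-ne3-p1/g22/D-ne3p1-g22-1.md` §2 S7), sub-row **K5c** (FINDING F-ne3leaf01g6-1 ∕ INTENT, `HOME/CLAIMS.log`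
2026-08-20 ≈18:08Z ∕ ≈18:15Z).  Kinematic kit for the interpolation–mean defect of the covariant tent interpolant (sequel
`NE3CovariantTentInterpolantMeanDefect`); independent of the interpolant itself.  Over the lineage's K5b-2 `NE3CoarseFrameData`
(`frameData U m z w = Ad (btree 1 U z w) (m w)`), NE3-R2's `AveragingDeficitBlockDensity` (`btree`, `bseg`, the uniform loop lemma
`norm_hol_closed_sub_one_le`, `norm_Ad_sub_Ad_le`) and leaf-09's `GaugeFieldPerturbation.norm_hol_sub_hol_le_of_forall` BY NAME.

CONTENT ([folklore]; 0 sorry; 0 def):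
§1 THE CONFIGURATION OF STRAIGHT SEGMENTS ALONG A TREE WORD: `hol (bseg M W) p (treeWord v) = W(Γ_{M•p, M•(p+v)})` for `v ≥ 0`
   (`hol_bseg_segNat`, `hol_bseg_tw`, `hol_bseg_treeWord`), hence **`btree_one_bseg_eq`** `btree 1 (bseg M W) z w = btree M W z (M•w)` (`z ≤ w`);
§2 THE THREE-LEG LOOP `M•w → y → M•z → M•w` (`threeLeg_eq_hol`; closed; length `|y − M•w|₁ + |y − M•z|₁ + |M•w − M•z|₁`);
§3 **`norm_vertexDefect_le`** (`[Nonempty n]`, `W`, `U` unitary, `SmallField W a`, `0 ≤ a`, `‖U − bseg M W‖ ≤ δ` bondwise, `z ≤ w`):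
   `‖m z − Ad_{btree_z(y)·btree_w(y)⁻¹}(m w)‖ ≤ ‖frameData U m z w − m z‖ + 2·(ℓ²·a + |w − z|₁·δ)·‖m w‖`;
§4 cell geometry in `ℓ¹`: `|v|₁ ≤ d·R` from coordinate bounds, and the coordinate bounds of block sites against cube corners
   (`abs_block_sub_vertex_le`, `abs_block_sub_corner_le`, `abs_vertex_sub_corner_le`, `abs_indic_le`).

HONEST FRAMING.  Kinematics at one background in the small-field class; nothing about Bałaban's minimisers; (P♮)_W ∕ (ML_w) at
W ≠ 1, T-E_w and **NE3 are NOT proved**; spine PROVED 0∕9; finite T⁴ rung (B)+1 — NOT infinite volume, NOT mass gap, NOT `BetaPertH`,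
NOT Clay.  PLACEMENT: `Summits/QuantumFields/BalabanUV/`.  HONEST DEPENDENCY (cell page 1): continuum YM on T⁴ ⇐ BetaPertH ∧ nine
spine estimates (0/9 proved); BetaPertH ⇐ (D1) ∧ (D4) ∧ CAP+tail; G-an2-4 gates asym, D1 and NE2/3/4.
-/

set_option autoImplicit false

open scoped BigOperators Matrix.Norms.L2Operator
open Finset

namespace Summit.QuantumFields.BalabanUV.T4Continuum.NE3CovariantVertexDefect

open Literature.MathematicalPhysics.QuantumFieldTheory.Balaban1983to89
open B7Prop1Explicit B7Prop2Explicit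
open B8Lemma1NonAbelian (tw tw_cons treeWord_eq_tw)
open T4AveragingDeficitWall (IsUnitaryCfg SmallField Ad)
open T4AveragingDeficitWallBoundary (periodBox mem_periodBox)
open T4AveragingDeficitNonAbelian (Ad_mul Ad_sub)
open AveragingDeficitTransport (norm_Ad_of_unitary mem_U1_of_unitary)
open AveragingDeficitBlockDensity (btree bseg btree_mem bseg_mem norm_hol_closed_sub_one_le norm_Ad_sub_Ad_le)
open SmoothRefineInterp (indic indic_apply)
open NE3CoarseFrameData (frameData frameData_self one_smul_site)
open GaugeFieldPerturbation (norm_hol_sub_hol_le_of_forall)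

noncomputable section

variable {d : ℕ} {n : Type*} [Fintype n] [DecidableEq n]

/-! ## §1 The configuration of straight segments along segments and tree words -/

/-- `hol (bseg M W) p [p, p + K e_κ] = W([M•p, M•p + MK e_κ])` (natural lengths). [folklore] -/
theorem hol_bseg_segNat (M : ℕ) (W : Site d → Fin d → (Matrix n n ℂ)ˣ) (κ : Fin d) :
    ∀ (K : ℕ) (p : Site d), hol (bseg M W) p (seg κ (K : ℤ)) = hol W ((M : ℤ) • p) (seg κ ((M * K : ℕ) : ℤ))
  | 0, p => by simp
  | K + 1, p => by
      have ih := hol_bseg_segNat M W κ K p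
      have hsplit : seg κ (((M * (K + 1) : ℕ) : ℤ)) = seg κ (((M * K : ℕ) : ℤ)) ++ seg κ ((M : ℕ) : ℤ) := by
        rw [seg_natCast, seg_natCast, seg_natCast, show M * (K + 1) = M * K + M by ring, List.replicate_add]
      rw [show ((K + 1 : ℕ) : ℤ) = (K : ℤ) + 1 by push_cast; rfl, hol_seg_natCast_succ, ih, hsplit, hol_append, disp_seg]
      congr 1
      simp only [bseg, smul_add, smul_smul]
      push_cast
      ring_nf

/-- **THE STRAIGHT-SEGMENT CONFIGURATION ALONG A TREE WALK** of a non-negative vector: for a list of directions `ks` and `v ≥ 0` on `ks`,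
`hol (bseg M W) p (tw ks v) = hol W (M•p) (tw ks (M•v))`. [folklore] -/
theorem hol_bseg_tw (M : ℕ) (W : Site d → Fin d → (Matrix n n ℂ)ˣ) :
    ∀ (ks : List (Fin d)) (v : Site d), (∀ κ ∈ ks, 0 ≤ v κ) → ∀ p : Site d,
      hol (bseg M W) p (tw ks v) = hol W ((M : ℤ) • p) (tw ks ((M : ℤ) • v))
  | [], _, _, _ => by simp
  | κ :: ks, v, hv, p => by
      obtain ⟨K, hK⟩ := Int.eq_ofNat_of_zero_le (hv κ List.mem_cons_self)
      have ih := hol_bseg_tw M W ks v (fun κ' h' => hv κ' (List.mem_cons_of_mem κ h')) (p + (K : ℤ) • e κ)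
      rw [tw_cons, tw_cons, hol_append, hol_append, disp_seg, disp_seg, hK, hol_bseg_segNat, ih, Pi.smul_apply, smul_eq_mul, hK,
        show (M : ℤ) * (K : ℤ) = ((M * K : ℕ) : ℤ) by push_cast; ring]
      congr 2
      rw [smul_add, smul_smul]
      push_cast
      rfl

/-- … along the full tree word: `hol (bseg M W) p (treeWord v) = hol W (M•p) (treeWord (M•v))` for `v ≥ 0`.
[cite: Balaban1985Averaging, p.20, p.24] -/
theorem hol_bseg_treeWord (M : ℕ) (W : Site d → Fin d → (Matrix n n ℂ)ˣ) (p : Site d) {v : Site d} (hv : 0 ≤ v) :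
    hol (bseg M W) p (treeWord v) = hol W ((M : ℤ) • p) (treeWord ((M : ℤ) • v)) := by
  rw [treeWord_eq_tw, treeWord_eq_tw]
  exact hol_bseg_tw M W _ v (fun κ _ => hv κ) p

/-- The coarse tree transport of the straight-segment configuration IS the fine tree transport between the corners:
`btree 1 (bseg M W) z w = btree M W z (M•w)` for `z ≤ w`. [folklore] -/
theorem btree_one_bseg_eq (M : ℕ) (W : Site d → Fin d → (Matrix n n ℂ)ˣ) {z w : Site d} (hzw : z ≤ w) :
    btree 1 (bseg M W) z w = btree M W z ((M : ℤ) • w) := by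
  unfold btree
  rw [one_smul_site, hol_bseg_treeWord M W z (sub_nonneg.mpr hzw), smul_sub]

/-! ## §2 The three-leg loop `M•w → y → M•z → M•w` -/

/-- `btree_w(y)·btree_z(y)⁻¹·btree_z(M•w)` is the holonomy from `M•w` of the closed word
`treeWord (y − M•w) ++ revWord (treeWord (y − M•z)) ++ treeWord (M•w − M•z)`. [cite: Balaban1985Averaging, (9) p.18] -/
theorem threeLeg_eq_hol (M : ℕ) (W : Site d → Fin d → (Matrix n n ℂ)ˣ) (y z w : Site d) :
    btree M W w y * (btree M W z y)⁻¹ * btree M W z ((M : ℤ) • w)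
      = hol W ((M : ℤ) • w)
          (treeWord (y - (M : ℤ) • w) ++ (revWord (treeWord (y - (M : ℤ) • z)) ++ treeWord ((M : ℤ) • w - (M : ℤ) • z))) := by
  rw [hol_append, hol_append]
  simp only [disp_treeWord, disp_revWord]
  have h1 : (M : ℤ) • w + (y - (M : ℤ) • w) = y := by abel
  have h2 : y + -(y - (M : ℤ) • z) = (M : ℤ) • z := by abel
  rw [h1, h2, hol_revWord' W (x := (M : ℤ) • z) y (treeWord (y - (M : ℤ) • z)) (by rw [disp_treeWord]; abel)]
  simp only [btree, mul_assoc]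

/-- The three-leg word is closed. [folklore] -/
theorem disp_threeLeg (M : ℕ) (y z w : Site d) :
    disp (treeWord (y - (M : ℤ) • w)
      ++ (revWord (treeWord (y - (M : ℤ) • z)) ++ treeWord ((M : ℤ) • w - (M : ℤ) • z) : List (Letter d))) = 0 := by
  simp only [disp_append, disp_revWord, disp_treeWord]
  abel

/-- The length of the three-leg word. [folklore] -/
theorem length_threeLeg (M : ℕ) (y z w : Site d) :
    (treeWord (y - (M : ℤ) • w)
      ++ (revWord (treeWord (y - (M : ℤ) • z)) ++ treeWord ((M : ℤ) • w - (M : ℤ) • z) : List (Letter d))).length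
      = l1 (y - (M : ℤ) • w) + l1 (y - (M : ℤ) • z) + l1 ((M : ℤ) • w - (M : ℤ) • z) := by
  simp only [List.length_append, length_revWord, length_treeWord]
  ring

/-! ## §3 The vertex datum read in the corner frame through a fine site -/

section Small

variable [Nonempty n]

/-- **THE VERTEX DEFECT** (`W`, `U` unitary, `SmallField W a`, `0 ≤ a`, `‖U − bseg M W‖ ≤ δ` bondwise, `z ≤ w`):
`‖m z − Ad_{btree_z(y)·btree_w(y)⁻¹}(m w)‖ ≤ ‖frameData U m z w − m z‖ + 2·(ℓ²·a + |w − z|₁·δ)·‖m w‖`,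
`ℓ = |y − M•w|₁ + |y − M•z|₁ + |M•w − M•z|₁`. [cite: Balaban1985Averaging, pp.24–25] -/
theorem norm_vertexDefect_le {M : ℕ} {W U : Site d → Fin d → (Matrix n n ℂ)ˣ} (hW : IsUnitaryCfg W) (hU : IsUnitaryCfg U)
    {a δ : ℝ} (ha : 0 ≤ a) (hWa : SmallField W a)
    (hδ : ∀ (x : Site d) (α : Fin d), ‖((U x α : (Matrix n n ℂ)ˣ) : Matrix n n ℂ) - bseg M W x α‖ ≤ δ)
    (m : Site d → Matrix n n ℂ) (y : Site d) {z w : Site d} (hzw : z ≤ w) :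
    ‖m z - Ad (btree M W z y * (btree M W w y)⁻¹) (m w)‖
      ≤ ‖frameData U m z w - m z‖
        + 2 * ((((l1 (y - (M : ℤ) • w) + l1 (y - (M : ℤ) • z) + l1 ((M : ℤ) • w - (M : ℤ) • z) : ℕ) : ℝ)) ^ 2 * a
            + (l1 (w - z) : ℝ) * δ) * ‖m w‖ := by
  set A : (Matrix n n ℂ)ˣ := btree 1 U z w with hA
  set B : (Matrix n n ℂ)ˣ := btree M W z y * (btree M W w y)⁻¹ with hB
  set C : (Matrix n n ℂ)ˣ := btree M W z ((M : ℤ) • w) with hC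
  have hAu : A ∈ unitaryUnits (Matrix n n ℂ) := btree_mem hU 1 z w
  have hBu : B ∈ unitaryUnits (Matrix n n ℂ) :=
    (unitaryUnits _).mul_mem (btree_mem hW M z y) ((unitaryUnits _).inv_mem (btree_mem hW M w y))
  have hCu : C ∈ unitaryUnits (Matrix n n ℂ) := btree_mem hW M z _
  -- split off the covariant cube increment
  have hsplit : m z - Ad B (m w) = (m z - frameData U m z w) + (Ad A (m w) - Ad B (m w)) := by
    simp only [frameData, hA]; abel
  rw [hsplit]
  refine (norm_add_le _ _).trans (add_le_add (by rw [norm_sub_rev]) ?_)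
  refine (norm_Ad_sub_Ad_le hAu hBu (m w)).trans ?_
  -- `B⁻¹A = (B⁻¹C)(C⁻¹A)`: the loop and the chain mismatch
  have hfac : B⁻¹ * A = (B⁻¹ * C) * (C⁻¹ * A) := by group
  set Γ : List (Letter d) := treeWord (y - (M : ℤ) • w)
      ++ (revWord (treeWord (y - (M : ℤ) • z)) ++ treeWord ((M : ℤ) • w - (M : ℤ) • z)) with hΓ
  have hloop : B⁻¹ * C = hol W ((M : ℤ) • w) Γ := by
    rw [hΓ, ← threeLeg_eq_hol, hB, hC, mul_inv_rev, inv_inv]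
  have hBC : ‖((B⁻¹ * C : (Matrix n n ℂ)ˣ) : Matrix n n ℂ) - 1‖
      ≤ (((l1 (y - (M : ℤ) • w) + l1 (y - (M : ℤ) • z) + l1 ((M : ℤ) • w - (M : ℤ) • z) : ℕ) : ℝ)) ^ 2 * a := by
    have h := norm_hol_closed_sub_one_le hW ha hWa ((M : ℤ) • w) Γ (by rw [hΓ]; exact disp_threeLeg M y z w)
    rwa [hΓ, length_threeLeg, ← hΓ, ← hloop] at h
  have hBC1 : ‖((B⁻¹ * C : (Matrix n n ℂ)ˣ) : Matrix n n ℂ)‖ ≤ 1 :=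
    (mem_U1.mp (mem_U1_of_unitary ((unitaryUnits _).mul_mem ((unitaryUnits _).inv_mem hBu) hCu))).1
  -- the chain mismatch `‖C⁻¹A − 1‖ ≤ ‖A − C‖ ≤ |w − z|₁·δ`
  have hCA : ‖((C⁻¹ * A : (Matrix n n ℂ)ˣ) : Matrix n n ℂ) - 1‖ ≤ (l1 (w - z) : ℝ) * δ := by
    have hCi1 : ‖(((C⁻¹ : (Matrix n n ℂ)ˣ)) : Matrix n n ℂ)‖ ≤ 1 := (mem_U1.mp (mem_U1_of_unitary hCu)).2
    have e1 : ((C⁻¹ * A : (Matrix n n ℂ)ˣ) : Matrix n n ℂ) - 1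
        = (((C⁻¹ : (Matrix n n ℂ)ˣ)) : Matrix n n ℂ) * ((A : Matrix n n ℂ) - (C : Matrix n n ℂ)) := by
      rw [Units.val_mul, mul_sub, Units.inv_mul]
    rw [e1]
    refine (norm_mul_le _ _).trans ?_
    have hAC : ‖(A : Matrix n n ℂ) - (C : Matrix n n ℂ)‖ ≤ (l1 (w - z) : ℝ) * δ := by
      have hA' : A = hol U z (treeWord (w - z)) := by rw [hA, btree, one_smul_site]
      have hC' : C = hol (bseg M W) z (treeWord (w - z)) := by
        rw [hC, ← btree_one_bseg_eq M W hzw, btree, one_smul_site]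
      rw [hA', hC']
      have h := norm_hol_sub_hol_le_of_forall (W := bseg M W) (W' := U)
        (fun x κ => mem_U1_of_unitary (bseg_mem hW M x κ)) (fun x κ => mem_U1_of_unitary (hU x κ)) hδ z (treeWord (w - z))
      rwa [length_treeWord] at h
    calc _ ≤ 1 * ((l1 (w - z) : ℝ) * δ) := mul_le_mul hCi1 hAC (norm_nonneg _) zero_le_one
      _ = _ := one_mul _
  have hprod : ‖((B⁻¹ * A : (Matrix n n ℂ)ˣ) : Matrix n n ℂ) - 1‖
      ≤ (((l1 (y - (M : ℤ) • w) + l1 (y - (M : ℤ) • z) + l1 ((M : ℤ) • w - (M : ℤ) • z) : ℕ) : ℝ)) ^ 2 * a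
          + (l1 (w - z) : ℝ) * δ := by
    rw [hfac, Units.val_mul]
    exact (B8Ineq170.norm_mul_sub_one_le_of_norm_le_one hBC1).trans (add_le_add hBC hCA)
  have h0 : 0 ≤ (((l1 (y - (M : ℤ) • w) + l1 (y - (M : ℤ) • z) + l1 ((M : ℤ) • w - (M : ℤ) • z) : ℕ) : ℝ)) ^ 2 * a
      + (l1 (w - z) : ℝ) * δ := (norm_nonneg _).trans hprod
  gcongr

end Small

/-! ## §4 Cell geometry in `ℓ¹` -/

/-- `|v|₁ ≤ d·R` when every coordinate of `v` lies in `[−R, R]`. [folklore] -/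
theorem l1_le_of_abs_le' {v : Site d} {R : ℕ} (h : ∀ j, -(R : ℤ) ≤ v j ∧ v j ≤ R) : l1 v ≤ d * R := by
  unfold l1
  calc ∑ κ, (v κ).natAbs ≤ ∑ _κ : Fin d, R := Finset.sum_le_sum fun κ _ => by have := h κ; omega
    _ = d * R := by simp

/-- Offsets of a block site against a cube corner: `|(M•z + v − M•(z + indic T))_j| ≤ M` for `v ∈ [0,M)^d`. [folklore] -/
theorem abs_block_sub_vertex_le {M : ℕ} (z : Site d) {v : Site d} (hv : v ∈ periodBox (d := d) M) (T : Finset (Fin d)) (j : Fin d) :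
    -(M : ℤ) ≤ ((M : ℤ) • z + v - (M : ℤ) • (z + indic T)) j ∧ ((M : ℤ) • z + v - (M : ℤ) • (z + indic T)) j ≤ M := by
  have h0 := (mem_periodBox.1 hv j).1
  have h1 := (mem_periodBox.1 hv j).2
  simp only [Pi.sub_apply, Pi.add_apply, Pi.smul_apply, smul_eq_mul, indic_apply, mul_add]
  split_ifs <;> constructor <;> linarith

/-- Offsets of a block site against its own corner: `|(M•z + v − M•z)_j| ≤ M` for `v ∈ [0,M)^d`. [folklore] -/
theorem abs_block_sub_corner_le {M : ℕ} (z : Site d) {v : Site d} (hv : v ∈ periodBox (d := d) M) (j : Fin d) :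
    -(M : ℤ) ≤ ((M : ℤ) • z + v - (M : ℤ) • z) j ∧ ((M : ℤ) • z + v - (M : ℤ) • z) j ≤ M := by
  have h0 := (mem_periodBox.1 hv j).1
  have h1 := (mem_periodBox.1 hv j).2
  simp only [Pi.sub_apply, Pi.add_apply, Pi.smul_apply, smul_eq_mul]
  constructor <;> linarith

/-- Corner against corner: `|(M•(z + indic T) − M•z)_j| ≤ M`. [folklore] -/
theorem abs_vertex_sub_corner_le (M : ℕ) (z : Site d) (T : Finset (Fin d)) (j : Fin d) :
    -(M : ℤ) ≤ ((M : ℤ) • (z + indic T) - (M : ℤ) • z) j ∧ ((M : ℤ) • (z + indic T) - (M : ℤ) • z) j ≤ M := by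
  have hM' : (0 : ℤ) ≤ M := by positivity
  simp only [Pi.sub_apply, Pi.smul_apply, Pi.add_apply, smul_eq_mul, indic_apply, mul_add]
  split_ifs <;> constructor <;> linarith

/-- The cube vertices sit above the corner: `|(z + indic T − z)_j| ≤ 1`. [folklore] -/
theorem abs_indic_le (z : Site d) (T : Finset (Fin d)) (j : Fin d) :
    -((1 : ℕ) : ℤ) ≤ (z + indic T - z) j ∧ (z + indic T - z) j ≤ ((1 : ℕ) : ℤ) := by
  simp only [Pi.sub_apply, Pi.add_apply, indic_apply]
  split_ifs <;> simp

end

end Summit.QuantumFields.BalabanUV.T4Continuum.NE3CovariantVertexDefect
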